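import Summits.QuantumFields.BalabanUV.Beta.D1BFx.GhostCompressionJets
import Summits.QuantumFields.BalabanUV.Beta.D1BFx.SortedEmbedding
import Mathlib.LinearAlgebra.Matrix.Rank

/-!
# `BalabanUV.Beta.D1BFx.GhostSplitJetsFree` — road «BF-x», binder row D1, slot (K), X₃(ii) ROUTE T, brick **K-TB3a PART 3** «THE GHOST SPLIT ON AN
# ARBITRARY FINE INDEX»: `GhostSplitJets.hessT_kkt_sq_jets` ∕ `…_of_mul_eq_one` with the fine index `σ ⊕ κ` inherited from `SliceTransferGhost`
# replaced by ANY finite index `ι` — by the re-indexing invariance of `hessT` (`SortedEmbedding.hessT_submatrix_equiv`), `kkt ∘ submatrix = submatrix ∘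
# kkt`, and a complement MANUFACTURED from `det S₀ ≠ 0` (which forces `|κ| ≤ |ι|`: `rank (Q₀X₀⁻¹Q₀ᵀ) ≤ rank Q₀ ≤ |ι|`), so that TB5 instantiates the
# split on the fine torus `Site 4 s` (or on its sorted form) with `Q₀ = TorusScalarAveraging.Qind` DIRECTLY — the «literal `σ ⊕ κ` typing» consumer
# step named by XREAD C-ne7bleaf01g20-1 (INFO-4), discharged once.

HONEST DEPENDENCY (cell records, verbatim): «continuum YM on T⁴ ⇐ BetaPertH ∧ nine spine estimates (0/9 proved); BetaPertH ⇐ (D1) ∧ (D4) ∧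
CAP+tail; G-an2-4 gates asym, D1 and NE2/3/4.»  HONEST FRAMING (cell contract, verbatim): «discharging `BetaPertH` makes Bałaban's UV stability
UNCONDITIONAL — a real constructive-QFT result; it is NOT the continuum limit and NOT the Clay problem.»  THIS MODULE DISCHARGES NOTHING of (K),
of D1 or of the wall: [folklore] finite-dimensional re-indexing bookkeeping over PART 1 `GhostSplitJets` (p239077), `SortedEmbedding.hessT_submatrix_equiv`
(p238419), `Composition.kkt`, `MixedVarPackedHess.hessT` and Mathlib (`Matrix.submatrix_mul_equiv`, `inv_submatrix_equiv`, `det_submatrix_equiv_self`,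
`rank_mul_le_left`, `rank_le_card_width`, `rank_of_isUnit`, `Fintype.equivOfCardEq`) — all USED BY NAME.  No definition, no `def … : Prop`,
nothing cited, 0 sorry.  NOT D1, NOT BetaPertH, NOT continuum, NOT Clay.

ABSOLUTE RULE (cell charter, verbatim): «No internally-minted statement may enter as a cited fact. Every hypothesis is either kernel-proved in this
package or a verbatim quotation of a PUBLISHED theorem with page reference. The manuscript(s) under audit are NOT citable for their own disputed
steps — they are the thing under adjudication; programme-internal (2001/route/tribunal) claims are never citable.»

WHERE THIS SITS (`HOME/b2b-balaban-beta-d1-p2/K-ASSEMBLY-SPEC-v2.md` v2.3 §2 row K-TB3a «GHOST SPLIT, JET FORM» (LANDED 2∕2: `GhostSplitJets` p239077,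
`GhostCompressionJets` p239613), §4 TB5).  PART 1's split is typed, like `SliceTransferGhost.secondVar_kkt_mul_self` it reads at `0`, with fine
matrices over `σ ⊕ κ` (`κ` = the coarse index); the determinant identity behind it needs no such splitting of the fine space.  TB5's fine index is
the fine torus `Beta.Site 4 s` (K-TB3b-J ∕ `PeriodisedProjector` currency) or the sorted `Site 4 p × (TorusSite 4 n × Unit)` (DECISION 1) — neither
is literally a `Sum` type.  THIS FILE removes the obstruction: §1 `kkt_submatrix` (any map), `kkt_submatrix_sumCongr` (equivalences),
`card_le_of_det_gram_ne_zero` (`det (Q₀GQ₀ᵀ) ≠ 0 ⟹ |κ| ≤ |ι|`); §2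
**`hessT_kkt_sq_jets_reindex`** (any `e : σ ⊕ κ ≃ ι`; the statement does not see `e`), **`hessT_kkt_sq_jets_free`** (NO complement, NO cardinality
hypothesis — both come from `det S₀ ≠ 0`), **`hessT_kkt_sq_jets_free_of_mul_eq_one`** (leg sockets `kkt X₀ Q₀ * L = 1`, `M₀ * Gm = 1`, `S₀ * Gs = 1`;
`det M₀ ≠ 0`, `det S₀ ≠ 0` now FOLLOW from the sockets); §3 the same service for PART 2's COMPRESSION: `submatrix_sandwich`, `submatrix_gram`,
**`hessT_compressed_jets_reindex`** (any `e : ρ ⊕ κ ≃ ι`, basis `N : Matrix ι ρ ℝ`), **`hessT_compressed_jets_free`** (only the dimension count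
`|ρ| + |κ| = |ι|`, which IS needed — a basis of a proper subspace of `ker Q` compresses to the wrong determinant — plus `det (kkt X₀ Q) ≠ 0`).
With `TorusScalarCoarseGram` (K-TB3c PART 2): at `U = 1`, `ι = Site 4 s`, `κ = Site 4 p`,
`M₀ = ÂX`, `Gm = Ĝ′` (`Ghat_mul_AXhat`), `Q₀ = Qind`, `S₀ = (m+1)⁴•k̂erSq` (`S0_letter`), `Gs = (m+1)⁻⁴•Ĉsq` (`S0_mul_inv_letter`).
NOT HERE: the bordered leg `L` (the N-side∕K-TB3b-J junction supplies `kkt X₀ Q₀`'s inverse), the jets (TB4), the `p → ∞` limits (TA3b∕K-TB3c PART 1).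
Provenance: NE9 formalisation swarm leaf seat `b2b-balaban-t4-ne9-formalise-leaf-02` gen 26 (cross-row prover duty NE9 → β∕D1 road «BF-x»; K-TB3a is
this lineage's brick, CLAIM l.22169), 2026-08-20.
-/

noncomputable section

namespace Summit.QuantumFields.BalabanUV.Beta.D1BFx.GhostSplitJetsFree

open Matrix
open Literature.MathematicalPhysics.QuantumFieldTheory.Balaban1983to89.Beta.Composition (kkt)
open Summit.QuantumFields.BalabanUV.Beta.D1BFx.MixedVarPackedHess (hessT)
open Summit.QuantumFields.BalabanUV.Beta.D1BFx.SortedEmbedding (hessT_submatrix_equiv)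
open Summit.QuantumFields.BalabanUV.Beta.D1BFx.GhostSplitJets (hessT_kkt_sq_jets hessT_kkt_sq_jets_of_mul_eq_one)
open Summit.QuantumFields.BalabanUV.Beta.D1BFx.GhostCompressionJets (hessT_compressed_jets logAbsDet_kkt_eq_compressed)

variable {ι κ σ τ ρ : Type*} [Fintype ι] [Fintype κ] [Fintype σ] [Fintype τ] [Fintype ρ] [DecidableEq ι] [DecidableEq κ] [DecidableEq σ]
  [DecidableEq τ] [DecidableEq ρ]

/-! ## §1 `kkt` and re-indexing of the fine index -/

omit [Fintype ι] [Fintype κ] [Fintype τ] [DecidableEq ι] [DecidableEq κ] [DecidableEq τ] in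
/-- [folklore] **`kkt` COMMUTES WITH RE-INDEXING OF THE FINE INDEX**: `kkt (X.submatrix e e) (Q.submatrix id e) = (kkt X Q).submatrix (Sum.map e id) (Sum.map e id)`
for ANY map `e : τ → ι` (entrywise, block by block). -/
theorem kkt_submatrix (X : Matrix ι ι ℝ) (Q : Matrix κ ι ℝ) (e : τ → ι) :
    kkt (X.submatrix e e) (Q.submatrix id e) = (kkt X Q).submatrix (Sum.map e id) (Sum.map e id) := by
  ext (i | i) (j | j) <;> rfl

omit [Fintype ι] [Fintype κ] [Fintype τ] [DecidableEq ι] [DecidableEq κ] [DecidableEq τ] in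
/-- [folklore] The `Equiv` form: `(kkt X Q).submatrix (e ⊕ 1) (e ⊕ 1) = kkt (X.submatrix e e) (Q.submatrix id e)` for `e : τ ≃ ι`. -/
theorem kkt_submatrix_sumCongr (X : Matrix ι ι ℝ) (Q : Matrix κ ι ℝ) (e : τ ≃ ι) :
    (kkt X Q).submatrix (e.sumCongr (Equiv.refl κ)) (e.sumCongr (Equiv.refl κ)) = kkt (X.submatrix e e) (Q.submatrix id e) := by
  rw [kkt_submatrix]
  rfl

omit [DecidableEq ι] in
/-- [folklore] **`det S₀ ≠ 0` FORCES `|κ| ≤ |ι|`** for `S₀ = Q₀·G·Q₀ᵀ` (`rank S₀ = |κ|`, `rank (Q₀ G Q₀ᵀ) ≤ rank Q₀ ≤ |ι|`). -/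
theorem card_le_of_det_gram_ne_zero (Q₀ : Matrix κ ι ℝ) (G : Matrix ι ι ℝ) (hS : (Q₀ * G * Q₀ᵀ).det ≠ 0) :
    Fintype.card κ ≤ Fintype.card ι := by
  have hU : IsUnit (Q₀ * G * Q₀ᵀ) := (Matrix.isUnit_iff_isUnit_det _).2 (isUnit_iff_ne_zero.2 hS)
  have h1 : (Q₀ * G * Q₀ᵀ).rank = Fintype.card κ := Matrix.rank_of_isUnit _ hU
  have h2 : (Q₀ * G * Q₀ᵀ).rank ≤ Fintype.card ι :=
    ((Matrix.rank_mul_le_left _ _).trans (Matrix.rank_mul_le_left _ _)).trans (Matrix.rank_le_card_width Q₀)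
  omega

/-! ## §2 The split on an arbitrary fine index -/

/-- [folklore] **THE GHOST SPLIT, JET FORM, RE-INDEXED**: `GhostSplitJets.hessT_kkt_sq_jets` for fine matrices over ANY finite `ι` equipped with an
equivalence `e : σ ⊕ κ ≃ ι` (the statement does not see `e`). -/
theorem hessT_kkt_sq_jets_reindex (e : σ ⊕ κ ≃ ι) (M₀ Mₛ Mₜ Mₛₜ X₀ Xₛ Xₜ Xₛₜ : Matrix ι ι ℝ) (Q₀ Qₛ Qₜ Qₛₜ : Matrix κ ι ℝ)
    (S₀ Sₛ Sₜ Sₛₜ : Matrix κ κ ℝ)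
    (hX₀ : X₀ = M₀ * M₀) (hXₛ : Xₛ = Mₛ * M₀ + M₀ * Mₛ) (hXₜ : Xₜ = Mₜ * M₀ + M₀ * Mₜ)
    (hXₛₜ : Xₛₜ = Mₛₜ * M₀ + Mₛ * Mₜ + Mₜ * Mₛ + M₀ * Mₛₜ)
    (hS₀ : S₀ = Q₀ * X₀⁻¹ * Q₀ᵀ)
    (hSₛ : Sₛ = Qₛ * X₀⁻¹ * Q₀ᵀ + Q₀ * X₀⁻¹ * Qₛᵀ - Q₀ * X₀⁻¹ * Xₛ * X₀⁻¹ * Q₀ᵀ)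
    (hSₜ : Sₜ = Qₜ * X₀⁻¹ * Q₀ᵀ + Q₀ * X₀⁻¹ * Qₜᵀ - Q₀ * X₀⁻¹ * Xₜ * X₀⁻¹ * Q₀ᵀ)
    (hSₛₜ : Sₛₜ = Qₛₜ * X₀⁻¹ * Q₀ᵀ + Qₛ * X₀⁻¹ * Qₜᵀ + Qₜ * X₀⁻¹ * Qₛᵀ + Q₀ * X₀⁻¹ * Qₛₜᵀ
        - Qₛ * X₀⁻¹ * Xₜ * X₀⁻¹ * Q₀ᵀ - Qₜ * X₀⁻¹ * Xₛ * X₀⁻¹ * Q₀ᵀ - Q₀ * X₀⁻¹ * Xₛ * X₀⁻¹ * Qₜᵀ - Q₀ * X₀⁻¹ * Xₜ * X₀⁻¹ * Qₛᵀ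
        + Q₀ * X₀⁻¹ * Xₛ * X₀⁻¹ * Xₜ * X₀⁻¹ * Q₀ᵀ + Q₀ * X₀⁻¹ * Xₜ * X₀⁻¹ * Xₛ * X₀⁻¹ * Q₀ᵀ - Q₀ * X₀⁻¹ * Xₛₜ * X₀⁻¹ * Q₀ᵀ)
    (hM : M₀.det ≠ 0) (hS : S₀.det ≠ 0) :
    hessT (kkt X₀ Q₀)⁻¹ (kkt Xₛ Qₛ) (kkt Xₜ Qₜ) (kkt Xₛₜ Qₛₜ) = 2 * hessT M₀⁻¹ Mₛ Mₜ Mₛₜ + hessT S₀⁻¹ Sₛ Sₜ Sₛₜ := by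
  -- transport the conclusion to the fine index `σ ⊕ κ` along `e` (and `e ⊕ 1` for the bordered system)
  rw [← hessT_submatrix_equiv (e.sumCongr (Equiv.refl κ)) (kkt X₀ Q₀)⁻¹, ← hessT_submatrix_equiv e M₀⁻¹,
    ← Matrix.inv_submatrix_equiv, ← Matrix.inv_submatrix_equiv, kkt_submatrix_sumCongr, kkt_submatrix_sumCongr, kkt_submatrix_sumCongr,
    kkt_submatrix_sumCongr]
  refine hessT_kkt_sq_jets (M₀.submatrix e e) (Mₛ.submatrix e e) (Mₜ.submatrix e e) (Mₛₜ.submatrix e e)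
    (X₀.submatrix e e) (Xₛ.submatrix e e) (Xₜ.submatrix e e) (Xₛₜ.submatrix e e)
    (Q₀.submatrix id e) (Qₛ.submatrix id e) (Qₜ.submatrix id e) (Qₛₜ.submatrix id e) S₀ Sₛ Sₜ Sₛₜ ?_ ?_ ?_ ?_ ?_ ?_ ?_ ?_ ?_ hS
  · rw [hX₀, Matrix.submatrix_mul_equiv]
  · rw [hXₛ]; simp only [Matrix.submatrix_mul_equiv]; ext i j; rfl
  · rw [hXₜ]; simp only [Matrix.submatrix_mul_equiv]; ext i j; rfl
  · rw [hXₛₜ]; simp only [Matrix.submatrix_mul_equiv]; ext i j; rfl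
  · rw [hS₀]; simp only [Matrix.transpose_submatrix, Matrix.inv_submatrix_equiv, Matrix.submatrix_mul_equiv, Matrix.submatrix_id_id]
  · rw [hSₛ]; simp only [Matrix.transpose_submatrix, Matrix.inv_submatrix_equiv, Matrix.submatrix_mul_equiv, Matrix.submatrix_id_id]
  · rw [hSₜ]; simp only [Matrix.transpose_submatrix, Matrix.inv_submatrix_equiv, Matrix.submatrix_mul_equiv, Matrix.submatrix_id_id]
  · rw [hSₛₜ]; simp only [Matrix.transpose_submatrix, Matrix.inv_submatrix_equiv, Matrix.submatrix_mul_equiv, Matrix.submatrix_id_id]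
  · rwa [Matrix.det_submatrix_equiv_self]

/-- [folklore] **THE GHOST SPLIT, JET FORM, ON AN ARBITRARY FINE INDEX** — `GhostSplitJets.hessT_kkt_sq_jets` for fine matrices over ANY finite `ι`,
with NO complement in the statement: `det S₀ ≠ 0` forces `|κ| ≤ |ι|` and the complement `Fin (|ι| − |κ|)` is manufactured (`Fintype.equivOfCardEq`). -/
theorem hessT_kkt_sq_jets_free (M₀ Mₛ Mₜ Mₛₜ X₀ Xₛ Xₜ Xₛₜ : Matrix ι ι ℝ) (Q₀ Qₛ Qₜ Qₛₜ : Matrix κ ι ℝ) (S₀ Sₛ Sₜ Sₛₜ : Matrix κ κ ℝ)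
    (hX₀ : X₀ = M₀ * M₀) (hXₛ : Xₛ = Mₛ * M₀ + M₀ * Mₛ) (hXₜ : Xₜ = Mₜ * M₀ + M₀ * Mₜ)
    (hXₛₜ : Xₛₜ = Mₛₜ * M₀ + Mₛ * Mₜ + Mₜ * Mₛ + M₀ * Mₛₜ)
    (hS₀ : S₀ = Q₀ * X₀⁻¹ * Q₀ᵀ)
    (hSₛ : Sₛ = Qₛ * X₀⁻¹ * Q₀ᵀ + Q₀ * X₀⁻¹ * Qₛᵀ - Q₀ * X₀⁻¹ * Xₛ * X₀⁻¹ * Q₀ᵀ)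
    (hSₜ : Sₜ = Qₜ * X₀⁻¹ * Q₀ᵀ + Q₀ * X₀⁻¹ * Qₜᵀ - Q₀ * X₀⁻¹ * Xₜ * X₀⁻¹ * Q₀ᵀ)
    (hSₛₜ : Sₛₜ = Qₛₜ * X₀⁻¹ * Q₀ᵀ + Qₛ * X₀⁻¹ * Qₜᵀ + Qₜ * X₀⁻¹ * Qₛᵀ + Q₀ * X₀⁻¹ * Qₛₜᵀ
        - Qₛ * X₀⁻¹ * Xₜ * X₀⁻¹ * Q₀ᵀ - Qₜ * X₀⁻¹ * Xₛ * X₀⁻¹ * Q₀ᵀ - Q₀ * X₀⁻¹ * Xₛ * X₀⁻¹ * Qₜᵀ - Q₀ * X₀⁻¹ * Xₜ * X₀⁻¹ * Qₛᵀ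
        + Q₀ * X₀⁻¹ * Xₛ * X₀⁻¹ * Xₜ * X₀⁻¹ * Q₀ᵀ + Q₀ * X₀⁻¹ * Xₜ * X₀⁻¹ * Xₛ * X₀⁻¹ * Q₀ᵀ - Q₀ * X₀⁻¹ * Xₛₜ * X₀⁻¹ * Q₀ᵀ)
    (hM : M₀.det ≠ 0) (hS : S₀.det ≠ 0) :
    hessT (kkt X₀ Q₀)⁻¹ (kkt Xₛ Qₛ) (kkt Xₜ Qₜ) (kkt Xₛₜ Qₛₜ) = 2 * hessT M₀⁻¹ Mₛ Mₜ Mₛₜ + hessT S₀⁻¹ Sₛ Sₜ Sₛₜ := by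
  have hcard : Fintype.card κ ≤ Fintype.card ι := card_le_of_det_gram_ne_zero Q₀ X₀⁻¹ (hS₀ ▸ hS)
  -- the manufactured complement `Fin (|ι| − |κ|)` (an `Equiv` by cardinality; `hessT` is blind to the choice)
  have hc : Fintype.card (Fin (Fintype.card ι - Fintype.card κ) ⊕ κ) = Fintype.card ι := by
    rw [Fintype.card_sum, Fintype.card_fin]; omega
  exact hessT_kkt_sq_jets_reindex (Fintype.equivOfCardEq hc) M₀ Mₛ Mₜ Mₛₜ X₀ Xₛ Xₜ Xₛₜ Q₀ Qₛ Qₜ Qₛₜ S₀ Sₛ Sₜ Sₛₜ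
    hX₀ hXₛ hXₜ hXₛₜ hS₀ hSₛ hSₜ hSₛₜ hM hS

/-- [folklore] **… WITH LEG SOCKETS** (the TB5 form, `GhostSplitJets.hessT_kkt_sq_jets_of_mul_eq_one` on an arbitrary fine index): any right inverses
`L` of `kkt X₀ Q₀`, `Gm` of `M₀`, `Gs` of `S₀` may stand in for the inverses. -/
theorem hessT_kkt_sq_jets_free_of_mul_eq_one (M₀ Mₛ Mₜ Mₛₜ X₀ Xₛ Xₜ Xₛₜ : Matrix ι ι ℝ) (Q₀ Qₛ Qₜ Qₛₜ : Matrix κ ι ℝ)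
    (S₀ Sₛ Sₜ Sₛₜ : Matrix κ κ ℝ) {L : Matrix (ι ⊕ κ) (ι ⊕ κ) ℝ} {Gm : Matrix ι ι ℝ} {Gs : Matrix κ κ ℝ}
    (hL : kkt X₀ Q₀ * L = 1) (hGm : M₀ * Gm = 1) (hGs : S₀ * Gs = 1)
    (hX₀ : X₀ = M₀ * M₀) (hXₛ : Xₛ = Mₛ * M₀ + M₀ * Mₛ) (hXₜ : Xₜ = Mₜ * M₀ + M₀ * Mₜ)
    (hXₛₜ : Xₛₜ = Mₛₜ * M₀ + Mₛ * Mₜ + Mₜ * Mₛ + M₀ * Mₛₜ)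
    (hS₀ : S₀ = Q₀ * X₀⁻¹ * Q₀ᵀ)
    (hSₛ : Sₛ = Qₛ * X₀⁻¹ * Q₀ᵀ + Q₀ * X₀⁻¹ * Qₛᵀ - Q₀ * X₀⁻¹ * Xₛ * X₀⁻¹ * Q₀ᵀ)
    (hSₜ : Sₜ = Qₜ * X₀⁻¹ * Q₀ᵀ + Q₀ * X₀⁻¹ * Qₜᵀ - Q₀ * X₀⁻¹ * Xₜ * X₀⁻¹ * Q₀ᵀ)
    (hSₛₜ : Sₛₜ = Qₛₜ * X₀⁻¹ * Q₀ᵀ + Qₛ * X₀⁻¹ * Qₜᵀ + Qₜ * X₀⁻¹ * Qₛᵀ + Q₀ * X₀⁻¹ * Qₛₜᵀ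
        - Qₛ * X₀⁻¹ * Xₜ * X₀⁻¹ * Q₀ᵀ - Qₜ * X₀⁻¹ * Xₛ * X₀⁻¹ * Q₀ᵀ - Q₀ * X₀⁻¹ * Xₛ * X₀⁻¹ * Qₜᵀ - Q₀ * X₀⁻¹ * Xₜ * X₀⁻¹ * Qₛᵀ
        + Q₀ * X₀⁻¹ * Xₛ * X₀⁻¹ * Xₜ * X₀⁻¹ * Q₀ᵀ + Q₀ * X₀⁻¹ * Xₜ * X₀⁻¹ * Xₛ * X₀⁻¹ * Q₀ᵀ - Q₀ * X₀⁻¹ * Xₛₜ * X₀⁻¹ * Q₀ᵀ) :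
    hessT L (kkt Xₛ Qₛ) (kkt Xₜ Qₜ) (kkt Xₛₜ Qₛₜ) = 2 * hessT Gm Mₛ Mₜ Mₛₜ + hessT Gs Sₛ Sₜ Sₛₜ := by
  have hS : S₀.det ≠ 0 := (Matrix.isUnit_det_of_right_inverse hGs).ne_zero
  have hM : M₀.det ≠ 0 := (Matrix.isUnit_det_of_right_inverse hGm).ne_zero
  rw [← Matrix.inv_eq_right_inv hL, ← Matrix.inv_eq_right_inv hGm, ← Matrix.inv_eq_right_inv hGs]
  exact hessT_kkt_sq_jets_free M₀ Mₛ Mₜ Mₛₜ X₀ Xₛ Xₜ Xₛₜ Q₀ Qₛ Qₜ Qₛₜ S₀ Sₛ Sₜ Sₛₜ hX₀ hXₛ hXₜ hXₛₜ hS₀ hSₛ hSₜ hSₛₜ hM hS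

/-! ## §3 The compression on an arbitrary fine index and an arbitrary basis index -/

omit [Fintype ρ] [DecidableEq ι] [DecidableEq κ] [DecidableEq ρ] [DecidableEq σ] [Fintype τ] [DecidableEq τ] in
/-- [folklore] A Gram sandwich is blind to re-indexing the fine index by an equivalence: `(N.submatrix e id)ᵀ·(X.submatrix e e)·(N.submatrix e id) = NᵀXN`. -/
theorem submatrix_sandwich (e : σ ⊕ κ ≃ ι) (X : Matrix ι ι ℝ) (N : Matrix ι ρ ℝ) :
    (N.submatrix e id)ᵀ * X.submatrix e e * N.submatrix e id = Nᵀ * X * N := by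
  rw [Matrix.transpose_submatrix, Matrix.submatrix_mul_equiv, Matrix.submatrix_mul_equiv, Matrix.submatrix_id_id]

omit [Fintype ρ] [DecidableEq ι] [DecidableEq κ] [DecidableEq ρ] [DecidableEq σ] [Fintype τ] [DecidableEq τ] in
/-- [folklore] The Gram of the re-indexed basis: `(N.submatrix e id)ᵀ·(N.submatrix e id) = NᵀN`. -/
theorem submatrix_gram (e : σ ⊕ κ ≃ ι) (N : Matrix ι ρ ℝ) : (N.submatrix e id)ᵀ * N.submatrix e id = Nᵀ * N := by
  rw [Matrix.transpose_submatrix, Matrix.submatrix_mul_equiv, Matrix.submatrix_id_id]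

/-- [folklore] **COMPRESSION IN THE `hessT` CURRENCY, RE-INDEXED**: `GhostCompressionJets.hessT_compressed_jets` for a fine index `ι` and a basis index `ρ`
tied by an equivalence `e : ρ ⊕ κ ≃ ι` (the statement does not see `e`): for `Q·N = 0`, `det(QQᵀ) ≠ 0`, `det(NᵀN) ≠ 0`, `det(NᵀX₀N) ≠ 0`,
`hessT (NᵀX₀N)⁻¹ (NᵀXₛN) (NᵀXₜN) (NᵀXₛₜN) = hessT (kkt X₀ Q)⁻¹ (kkt Xₛ 0) (kkt Xₜ 0) (kkt Xₛₜ 0)`. -/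
theorem hessT_compressed_jets_reindex (e : ρ ⊕ κ ≃ ι) (X₀ Xₛ Xₜ Xₛₜ : Matrix ι ι ℝ) (Q : Matrix κ ι ℝ) (N : Matrix ι ρ ℝ)
    (hQN : Q * N = 0) (hQ : (Q * Qᵀ).det ≠ 0) (hN : (Nᵀ * N).det ≠ 0) (hd : (Nᵀ * X₀ * N).det ≠ 0) :
    hessT (Nᵀ * X₀ * N)⁻¹ (Nᵀ * Xₛ * N) (Nᵀ * Xₜ * N) (Nᵀ * Xₛₜ * N)
      = hessT (kkt X₀ Q)⁻¹ (kkt Xₛ (0 : Matrix κ ι ℝ)) (kkt Xₜ (0 : Matrix κ ι ℝ)) (kkt Xₛₜ (0 : Matrix κ ι ℝ)) := by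
  have h := hessT_compressed_jets (X₀.submatrix e e) (Xₛ.submatrix e e) (Xₜ.submatrix e e) (Xₛₜ.submatrix e e) (Q.submatrix id e) (N.submatrix e id)
    (by rw [Matrix.submatrix_mul_equiv, hQN, Matrix.submatrix_id_id])
    (by rwa [Matrix.transpose_submatrix, Matrix.submatrix_mul_equiv, Matrix.submatrix_id_id])
    (by rwa [submatrix_gram]) (by rwa [submatrix_sandwich])
  rw [submatrix_sandwich, submatrix_sandwich, submatrix_sandwich, submatrix_sandwich] at h
  rw [h, ← hessT_submatrix_equiv (e.sumCongr (Equiv.refl κ)) (kkt X₀ Q)⁻¹, ← Matrix.inv_submatrix_equiv, kkt_submatrix_sumCongr,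
    kkt_submatrix_sumCongr, kkt_submatrix_sumCongr, kkt_submatrix_sumCongr, Matrix.submatrix_zero]
  rfl

/-- [folklore] **COMPRESSION ON AN ARBITRARY FINE INDEX** with only the DIMENSION COUNT `|ρ| + |κ| = |ι|` (which IS needed: a basis `N` of a proper
subspace of `ker Q` would compress to the wrong determinant), plus the non-degeneracy `det (kkt X₀ Q) ≠ 0` it entails
(`GhostCompressionJets.logAbsDet_kkt_eq_compressed`). -/
theorem hessT_compressed_jets_free (hcard : Fintype.card ρ + Fintype.card κ = Fintype.card ι) (X₀ Xₛ Xₜ Xₛₜ : Matrix ι ι ℝ) (Q : Matrix κ ι ℝ)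
    (N : Matrix ι ρ ℝ) (hQN : Q * N = 0) (hQ : (Q * Qᵀ).det ≠ 0) (hN : (Nᵀ * N).det ≠ 0) (hd : (Nᵀ * X₀ * N).det ≠ 0) :
    hessT (Nᵀ * X₀ * N)⁻¹ (Nᵀ * Xₛ * N) (Nᵀ * Xₜ * N) (Nᵀ * Xₛₜ * N)
        = hessT (kkt X₀ Q)⁻¹ (kkt Xₛ (0 : Matrix κ ι ℝ)) (kkt Xₜ (0 : Matrix κ ι ℝ)) (kkt Xₛₜ (0 : Matrix κ ι ℝ)) ∧
      (kkt X₀ Q).det ≠ 0 := by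
  have hc : Fintype.card (ρ ⊕ κ) = Fintype.card ι := by rw [Fintype.card_sum]; exact hcard
  set e : ρ ⊕ κ ≃ ι := Fintype.equivOfCardEq hc
  refine ⟨hessT_compressed_jets_reindex e X₀ Xₛ Xₜ Xₛₜ Q N hQN hQ hN hd, ?_⟩
  have h := (logAbsDet_kkt_eq_compressed (X₀.submatrix e e) (Q.submatrix id e) (N.submatrix e id)
    (by rw [Matrix.submatrix_mul_equiv, hQN, Matrix.submatrix_id_id])
    (by rwa [Matrix.transpose_submatrix, Matrix.submatrix_mul_equiv, Matrix.submatrix_id_id])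
    (by rwa [submatrix_gram]) (by rwa [submatrix_sandwich])).1
  rwa [← kkt_submatrix_sumCongr, Matrix.det_submatrix_equiv_self] at h

end Summit.QuantumFields.BalabanUV.Beta.D1BFx.GhostSplitJetsFree

end
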